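import Summits.ValiantsHypothesis.ValiantsHypothesis.Theses.SymmetroidDescartes
import Summits.ValiantsHypothesis.ValiantsHypothesis.Theorems.SymmetroidDescartesRolleToDescartes

/-!
# Strategy sketch for crux `DerivedPencilRolle` (stmt-ValiantsHypothesis-18500) — typed census statements

Planner (crux-strategist) scratch file: the signatures quoted in `STRATEGY-CENSUS.md`
(strengthen / decomposition / transfer / negation), elaborated against the route file.
Nothing here is a route item.
-/

set_option linter.dupNamespace false

namespace Summit.ValiantsHypothesis.ValiantsHypothesis.Cruxes.DerivedPencilRolle.Strategy

open scoped BigOperators Polynomial Matrix Classical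
open Summit.ValiantsHypothesis.ValiantsHypothesis.Theses.SymmetroidDescartes

/-- the lacunary pencil `∑ X^(d l) • S l` as a polynomial matrix -/
noncomputable def pencil {n m : ℕ} (S : Fin n → Matrix (Fin m) (Fin m) ℝ) (d : Fin n → ℕ) :
    Matrix (Fin m) (Fin m) ℝ[X] :=
  ∑ l, (Polynomial.X : ℝ[X]) ^ d l • (S l).map Polynomial.C

/-- number of distinct positive roots -/
noncomputable def posRoots (p : ℝ[X]) : ℕ := (p.roots.toFinset.filter (fun t => 0 < t)).card

/-- the derived `K`-term pencil `∂F = d/dt (t^(-d₀) F)` of a `(K+1)`-term pencil (the crux's). -/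
noncomputable def derived {m K : ℕ} (S : Fin (K + 1) → Matrix (Fin m) (Fin m) ℝ) (d : Fin (K + 1) → ℕ) :
    Matrix (Fin m) (Fin m) ℝ[X] :=
  ∑ l : Fin K, (Polynomial.X : ℝ[X]) ^ (d l.succ - d 0 - 1) •
    (((d l.succ - d 0 : ℕ) : ℝ) • S l.succ).map Polynomial.C

/-- The crux in this notation (definitional). -/
theorem crux_iff : DerivedPencilRolle ↔
    ∃ C a : ℕ, ∀ (m K : ℕ) (S : Fin (K + 1) → Matrix (Fin m) (Fin m) ℝ) (d : Fin (K + 1) → ℕ),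
      (∀ l, (S l).IsSymm) → (∀ l, (S l).det ≠ 0) → StrictMono d →
      posRoots (pencil S d).det ≤ C * posRoots (derived S d).det + (m + K) ^ a :=
  Iff.rfl

/-! ## Strengthen -/

/-- **S⁺ = PolyRootBound** (polynomial matrix Descartes rule for the crux's class). -/
def PolyRootBound : Prop :=
  ∃ a : ℕ, ∀ (m K : ℕ) (S : Fin (K + 1) → Matrix (Fin m) (Fin m) ℝ) (d : Fin (K + 1) → ℕ),
    (∀ l, (S l).IsSymm) → (∀ l, (S l).det ≠ 0) → StrictMono d →
    posRoots (pencil S d).det ≤ (m + K) ^ a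

/-- S⁺ ⇒ crux, with `C = 0`: the Rolle structure of the crux is then vacuous. -/
theorem derivedPencilRolle_of_polyRootBound (h : PolyRootBound) : DerivedPencilRolle := by
  obtain ⟨a, ha⟩ := h
  rw [crux_iff]
  exact ⟨0, a, fun m K S d hS hdet hd => by simpa using ha m K S d hS hdet hd⟩

/-- **ExpRootBound** — the exponential-in-`K` matrix Descartes rule; this (not the Rolle structure)
is what `RolleToDescartes`/`closes` consume. -/
def ExpRootBound : Prop :=
  ∃ C a : ℕ, ∀ (m K : ℕ) (S : Fin (K + 1) → Matrix (Fin m) (Fin m) ℝ) (d : Fin (K + 1) → ℕ),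
    (∀ l, (S l).IsSymm) → (∀ l, (S l).det ≠ 0) → StrictMono d →
    posRoots (pencil S d).det ≤ (K + 1) * C ^ K * (m + K) ^ a

/-- crux ⇒ ExpRootBound (the tree's iteration lemma). -/
theorem expRootBound_of_derivedPencilRolle (h : DerivedPencilRolle) : ExpRootBound := by
  obtain ⟨C, a, -, hb⟩ := Theorems.SymmetroidDescartes.posRoots_le_of_derivedPencilRolle h
  exact ⟨C, a, fun m K S d hS hdet hd => hb K m S d hS hdet hd⟩

/-! ## Negation: what a counterexample must exhibit -/

/-- ¬crux forces SUPERPOLYNOMIAL positive-root counts to exist in the class (contrapositive of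
`derivedPencilRolle_of_polyRootBound`): refuting the crux is at least as hard as refuting S⁺. -/
theorem not_polyRootBound_of_not_crux (h : ¬ DerivedPencilRolle) : ¬ PolyRootBound :=
  fun hp => h (derivedPencilRolle_of_polyRootBound hp)

/-- unfolded: for every exponent `a` some pencil has more than `(m+K)^a` distinct positive roots. -/
theorem superpoly_of_not_crux (h : ¬ DerivedPencilRolle) (a : ℕ) :
    ∃ (m K : ℕ) (S : Fin (K + 1) → Matrix (Fin m) (Fin m) ℝ) (d : Fin (K + 1) → ℕ),
      (∀ l, (S l).IsSymm) ∧ (∀ l, (S l).det ≠ 0) ∧ StrictMono d ∧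
      (m + K) ^ a < posRoots (pencil S d).det := by
  have hn := not_polyRootBound_of_not_crux h
  simp only [PolyRootBound, not_exists, not_forall, not_le] at hn
  obtain ⟨m, K, S, d, hS, hdet, hd, hlt⟩ := hn a
  exact ⟨m, K, S, d, hS, hdet, hd, hlt⟩

/-! ## Decomposition candidates -/

/-- (D1) the shape EVERY inertia-interval argument yields (Loewner monotonicity on definite stretches of
`∂F`, one charge per stretch): MULTIPLICATIVE in the derived count. It does not imply the crux and its
`K`-fold iterate is `(m+K)^(aK)`, useless in the regime `log m = c·log²K`. -/
def IntervalRolle : Prop :=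
  ∃ a : ℕ, ∀ (m K : ℕ) (S : Fin (K + 1) → Matrix (Fin m) (Fin m) ℝ) (d : Fin (K + 1) → ℕ),
    (∀ l, (S l).IsSymm) → (∀ l, (S l).det ≠ 0) → StrictMono d →
    posRoots (pencil S d).det ≤ (posRoots (derived S d).det + 1) * (m + K) ^ a

/-- (D2) the provable special case (Loewner/Sylvester, elementary): if the derived pencil is positive
semidefinite at every `t > 0` then the ordered eigenvalues of `t^(-d₀)F(t)` are nondecreasing and
`det F` has at most `m` positive roots. -/
def SemidefiniteCase : Prop :=
  ∀ (m K : ℕ) (S : Fin (K + 1) → Matrix (Fin m) (Fin m) ℝ) (d : Fin (K + 1) → ℕ),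
    (∀ l, (S l).IsSymm) → (∀ l, (S l).det ≠ 0) → StrictMono d →
    (∀ t : ℝ, 0 < t →
      (∑ l : Fin K, (((d l.succ - d 0 : ℕ) : ℝ) * t ^ (d l.succ - d 0 - 1)) • S l.succ).PosSemidef) →
    posRoots (pencil S d).det ≤ m

/-- (D3a) regime split, few terms: `K ≤ κ·log₂(m+K)` — here `ExpRootBound`-type bounds are already
polynomial, no Rolle content needed. -/
def FewTermsCase (κ : ℕ) : Prop :=
  ∃ a : ℕ, ∀ (m K : ℕ) (S : Fin (K + 1) → Matrix (Fin m) (Fin m) ℝ) (d : Fin (K + 1) → ℕ),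
    (∀ l, (S l).IsSymm) → (∀ l, (S l).det ≠ 0) → StrictMono d →
    K ≤ κ * Nat.log 2 (m + K) → posRoots (pencil S d).det ≤ (m + K) ^ a

/-- (D3b) regime split, many terms: the crux restricted to `K > κ·log₂(m+K)` — this IS the crux on the
route's regime (`log₂ m = c·(log₂K+1)² ≪ K`): the split hides all difficulty here. -/
def ManyTermsRolle (κ : ℕ) : Prop :=
  ∃ C a : ℕ, ∀ (m K : ℕ) (S : Fin (K + 1) → Matrix (Fin m) (Fin m) ℝ) (d : Fin (K + 1) → ℕ),
    (∀ l, (S l).IsSymm) → (∀ l, (S l).det ≠ 0) → StrictMono d →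
    κ * Nat.log 2 (m + K) < K → posRoots (pencil S d).det ≤ C * posRoots (derived S d).det + (m + K) ^ a

/-- `m = 0`: the determinant of the empty pencil is `1`, no roots. -/
theorem posRoots_pencil_zero {n : ℕ} (S : Fin n → Matrix (Fin 0) (Fin 0) ℝ) (d : Fin n → ℕ) :
    posRoots (pencil S d).det = 0 := by
  simp [posRoots, Matrix.det_isEmpty]

/-- the regime split composes into the crux (typed glue `D3a → D3b → crux`). -/
theorem derivedPencilRolle_of_split (κ : ℕ) (h₁ : FewTermsCase κ) (h₂ : ManyTermsRolle κ) :
    DerivedPencilRolle := by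
  obtain ⟨a₁, h₁⟩ := h₁
  obtain ⟨C, a₂, h₂⟩ := h₂
  rw [crux_iff]
  refine ⟨C, a₁ + a₂, fun m K S d hS hdet hd => ?_⟩
  rcases Nat.eq_zero_or_pos (m + K) with hmK | hmK
  · have hm : m = 0 := by omega
    subst hm
    rw [posRoots_pencil_zero]
    exact Nat.zero_le _
  rcases Nat.lt_or_ge (κ * Nat.log 2 (m + K)) K with hK | hK
  · calc posRoots (pencil S d).det ≤ C * posRoots (derived S d).det + (m + K) ^ a₂ :=
          h₂ m K S d hS hdet hd hK
      _ ≤ C * posRoots (derived S d).det + (m + K) ^ (a₁ + a₂) :=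
          Nat.add_le_add_left (Nat.pow_le_pow_right hmK (Nat.le_add_left _ _)) _
  · calc posRoots (pencil S d).det ≤ (m + K) ^ a₁ := h₁ m K S d hS hdet hd hK
      _ ≤ (m + K) ^ (a₁ + a₂) := Nat.pow_le_pow_right hmK (Nat.le_add_right _ _)
      _ ≤ C * posRoots (derived S d).det + (m + K) ^ (a₁ + a₂) := Nat.le_add_left _ _

/-- `ExpRootBound` discharges the few-terms piece (`(K+1)·C^K ≤ (m+K)^(κ') when K ≤ κ log₂(m+K)`);
stated, proof routine (omitted here). -/
def ExpRootBound_implies_FewTerms : Prop := ExpRootBound → ∀ κ, FewTermsCase κ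

/-- (D4) bridge split `ExpRootBound ∧ (ExpRootBound → crux)`: typed, glue = modus ponens; the second
piece is the crux conditioned on its own iterate (marginally weaker, same wall). -/
theorem derivedPencilRolle_of_bridge (h₁ : ExpRootBound) (h₂ : ExpRootBound → DerivedPencilRolle) :
    DerivedPencilRolle := h₂ h₁

/-! ## Transfer: the additive Rolle partner exists but keeps the number of generators -/

/-- `R_F := Res_λ( charpoly G , tr(adj(λI − G)·DG) )` for `G = ∑ X^(d l − d 0) • S l` and `D = t·d/dt`
(`DG = ∑ (d l − d 0)·X^(d l − d 0) • S l`). Analytically `R_F = ± Disc_λ(charpoly G)·∏ᵢ uᵢᵀ(DG)uᵢ`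
(Rellich frame), whose zeros are the stationary points of the eigenbranches; between consecutive zeros
every branch is monotone, giving the ADDITIVE matrix Rolle inequality below. But `R_F` is again a
polynomial in the SAME `K+1` generators `t^(d l)` (degree `O(m²)`), so no induction parameter drops. -/
noncomputable def rollePartner {m K : ℕ} (S : Fin (K + 1) → Matrix (Fin m) (Fin m) ℝ)
    (d : Fin (K + 1) → ℕ) : ℝ[X] :=
  let G : Matrix (Fin m) (Fin m) ℝ[X] := ∑ l, (Polynomial.X : ℝ[X]) ^ (d l - d 0) • (S l).map Polynomial.C
  let DG : Matrix (Fin m) (Fin m) ℝ[X] :=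
    ∑ l, (Polynomial.C ((d l - d 0 : ℕ) : ℝ) * (Polynomial.X : ℝ[X]) ^ (d l - d 0)) • (S l).map Polynomial.C
  Polynomial.resultant G.charpoly ((Matrix.charmatrix G).adjugate * DG.map Polynomial.C).trace

/-- additive matrix Rolle (true by analytic perturbation theory when `R_F ≢ 0`; Lean: XL). -/
def AdditiveRolle : Prop :=
  ∀ (m K : ℕ) (S : Fin (K + 1) → Matrix (Fin m) (Fin m) ℝ) (d : Fin (K + 1) → ℕ),
    (∀ l, (S l).IsSymm) → (∀ l, (S l).det ≠ 0) → StrictMono d → rollePartner S d ≠ 0 →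
    posRoots (pencil S d).det ≤ m + posRoots (rollePartner S d)

/-! ## Sanity: degenerate instances compute -/

example : posRoots (1 : ℝ[X]) = 0 := by simp [posRoots]

end Summit.ValiantsHypothesis.ValiantsHypothesis.Cruxes.DerivedPencilRolle.Strategy
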